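import Summits.QuantumFields.YangMills.Theorems.UnitScaleTiltCurvGradFlatPoisson
import Literature.MathematicalPhysics.QuantumFieldTheory.CubicalChainsHodge
import Mathlib.Analysis.Normed.Module.DoubleDual
import HarnessLib

/-!
# Flat-lattice input of the curvature-gradient bound, file 3: the VECTOR-VALUED estimate (by duality) and its 2-TENSOR form —
# `‖∇M(0)‖ ≤ C(1 + log R)((d+2)(sup‖div₂ M‖ + sup‖d₂ M‖) + sup‖M‖/R)` for every 2-tensor `M` on `ℤ^d` with values in a real normed space

Helper file (`--supports stmt-QuantumFields-19200`, crux child «MinimiserStabilityRegPr» of rung R3's K1, cell `ym3-torus`, seat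
`ym3-torus-p1` gen 13; memo HOME/UV3-NODE.md §22).  Theorems only; no new definition.

* §1 `divForm_norm_sub_le` — `…CurvGradFlatPoisson.divForm_sub_le'` for functions with values in a real normed space `E`
  (Hahn–Banach: Mathlib `NormedSpace.norm_le_dual_bound`, applied to `φ ∘ u` for every `φ` in the dual);
* §2 **`tensor_norm_sub_le`** — for `M : ℤ^d → (Fin d)² → E` with `‖M‖ ≤ M₀`, `‖div₂ M‖ ≤ M₁`, `‖d₂ M‖ ≤ M₂` on the sup-box of
  radius `4R` (`R ≥ 4`): `‖M(±e_j; κ, μ) − M(0; κ, μ)‖ ≤ C(1 + log R)((d + 2)(M₁ + M₂) + M₀/R)` — every component of the tree's Hodge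
  identity `div₃ (d₂ M) + d₁ (div₂ M) = negLap₂ M` (`LatticeChain.div₃_d₂_add_d₁_div₂`, valid for ALL 2-tensors) is a
  divergence-form Poisson equation with `d + 2` data terms.
This is the form consumed by the gauge side (`…CurvGradAxialFlat`): `M = F̃ − 1`, the plaquette field in the complete axial gauge.

References: G. F. Lawler, V. Limic, *Random Walk: A Modern Introduction* (2010) (kernel bounds); J. Fröhlich, T. Spencer, CMP 83 (1982)
§2.3 (the lattice Hodge identity, tree `CubicalChainsHodge`).  No sorry, standard axioms.  NOT a claim about the mass gap.
-/

set_option autoImplicit false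

noncomputable section

open Finset
open Literature.Probability.LatticeModels
open Literature.MathematicalPhysics.QuantumFieldTheory.LatticeForm (e d₁ d₂)
open Literature.MathematicalPhysics.QuantumFieldTheory.LatticeChain (div₂ div₃ negLap₂ div₃_d₂_add_d₁_div₂)

namespace Summit.QuantumFields.YangMills.Theorems.CurvGradFlat

variable {d : ℕ} {E : Type*} [NormedAddCommGroup E] [NormedSpace ℝ E]

/-! ## §1 Vector-valued form by duality -/

/-- **THE DIVERGENCE-FORM ESTIMATE FOR VECTOR-VALUED FUNCTIONS**: `…CurvGradFlatPoisson.divForm_sub_le'` with `u, g_k : ℤ^d → E`,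
`E` any real normed space, norms in place of absolute values (apply the scalar estimate to `φ ∘ u` for each `φ ∈ E*`, then
`NormedSpace.norm_le_dual_bound`). [folklore] -/
theorem divForm_norm_sub_le (hd : 3 ≤ d) : ∃ C : ℝ, 0 < C ∧ ∀ (R : ℕ), 4 ≤ R →
    ∀ (m : ℕ) (u : Site d → E) (g : Fin m → Site d → E) (v : Fin m → Site d) (M₀ M : ℝ),
    (∀ k, ∃ i, v k = e i ∨ v k = -e i) →
    (∀ z : Site d, (∀ k, |z k| ≤ 4 * (R : ℤ)) → ‖u z‖ ≤ M₀) →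
    (∀ z : Site d, (∀ k, |z k| ≤ 4 * (R : ℤ)) → ∀ k, ‖g k z‖ ≤ M) →
    (∀ z : Site d, (∀ k, |z k| ≤ 4 * (R : ℤ)) → ∑ i, ((u z - u (z + e i)) + (u z - u (z - e i))) = ∑ k, (g k (z + v k) - g k z)) →
    ∀ j : Fin d, ‖u (e j) - u 0‖ ≤ C * (1 + Real.log R) * (m * M + M₀ / R) ∧
      ‖u (-e j) - u 0‖ ≤ C * (1 + Real.log R) * (m * M + M₀ / R) := by
  obtain ⟨C, hC, h⟩ := divForm_sub_le' (d := d) hd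
  refine ⟨C, hC, fun R hR m u g v M₀ M hv hu hgM heq j => ?_⟩
  have hR1 : (1 : ℝ) ≤ R := by exact_mod_cast (show 1 ≤ R by omega)
  have hRpos : (0 : ℝ) < R := by linarith
  have hM0 : 0 ≤ M₀ := (norm_nonneg _).trans (hu 0 fun k => by simp only [Pi.zero_apply, abs_zero]; positivity)
  have hmM : 0 ≤ (m : ℝ) * M := by
    rcases Nat.eq_zero_or_pos m with hm | hm
    · rw [hm, Nat.cast_zero, zero_mul]
    · have : 0 ≤ M := (norm_nonneg _).trans (hgM 0 (fun k => by simp only [Pi.zero_apply, abs_zero]; positivity) ⟨0, hm⟩)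
      positivity
  have hB0 : 0 ≤ C * (1 + Real.log R) * (m * M + M₀ / R) := by
    have : 0 ≤ Real.log R := Real.log_nonneg hR1
    positivity
  -- the scalar estimate for `φ ∘ u`
  have key : ∀ φ : StrongDual ℝ E, |φ (u (e j)) - φ (u 0)| ≤ C * (1 + Real.log R) * (m * (‖φ‖ * M) + ‖φ‖ * M₀ / R) ∧
      |φ (u (-e j)) - φ (u 0)| ≤ C * (1 + Real.log R) * (m * (‖φ‖ * M) + ‖φ‖ * M₀ / R) := by
    intro φ
    refine h R hR m (fun z => φ (u z)) (fun k z => φ (g k z)) v (‖φ‖ * M₀) (‖φ‖ * M) hv (fun z hz => ?_) (fun z hz k => ?_)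
      (fun z hz => ?_) j
    · exact (φ.le_opNorm _).trans (mul_le_mul_of_nonneg_left (hu z hz) (norm_nonneg _))
    · exact (φ.le_opNorm _).trans (mul_le_mul_of_nonneg_left (hgM z hz k) (norm_nonneg _))
    · have := congrArg φ (heq z hz)
      simpa only [map_sum, map_add, map_sub] using this
  have hφ : ∀ φ : StrongDual ℝ E, C * (1 + Real.log R) * (m * (‖φ‖ * M) + ‖φ‖ * M₀ / R) =
      C * (1 + Real.log R) * (m * M + M₀ / R) * ‖φ‖ := fun φ => by ring
  constructor
  · refine NormedSpace.norm_le_dual_bound ℝ _ hB0 fun φ => ?_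
    rw [← hφ, Real.norm_eq_abs, map_sub]; exact (key φ).1
  · refine NormedSpace.norm_le_dual_bound ℝ _ hB0 fun φ => ?_
    rw [← hφ, Real.norm_eq_abs, map_sub]; exact (key φ).2

/-! ## §2 The 2-tensor (div–curl) form -/

/-- **INTERIOR LOG-LIPSCHITZ ESTIMATE FOR A LATTICE 2-TENSOR FROM ITS DIVERGENCE AND COBOUNDARY** (`d ≥ 3`, any real normed space `E`):
there is `C > 0` such that for `R ≥ 4` and every `M : ℤ^d → Fin d → Fin d → E` with, on the sup-box `{|z_k| ≤ 4R}`,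
`‖M(z; κ, μ)‖ ≤ M₀`, `‖(div₂ M)(z; a)‖ ≤ M₁` and `‖(d₂ M)(z; a, b, c)‖ ≤ M₂` (ALL index values), for all `j, κ, μ`:
`‖M(e_j; κ, μ) − M(0; κ, μ)‖ , ‖M(−e_j; κ, μ) − M(0; κ, μ)‖ ≤ C·(1 + log R)·((d + 2)(M₁ + M₂) + M₀/R)`.
Each component of `div₃ (d₂ M) + d₁ (div₂ M) = negLap₂ M` (tree, Fröhlich–Spencer's `−Δ = dδ + δd`) is a divergence-form equation
with the `d` data `(d₂ M)(·; j, κ, μ)` (steps `−e_j`) and the two data `(div₂ M)(·; μ)`, `−(div₂ M)(·; κ)` (steps `e_κ`, `e_μ`).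
[folklore] -/
theorem tensor_norm_sub_le (hd : 3 ≤ d) : ∃ C : ℝ, 0 < C ∧ ∀ (R : ℕ), 4 ≤ R →
    ∀ (M : Site d → Fin d → Fin d → E) (M₀ M₁ M₂ : ℝ),
    (∀ z : Site d, (∀ k, |z k| ≤ 4 * (R : ℤ)) → ∀ κ μ, ‖M z κ μ‖ ≤ M₀) →
    (∀ z : Site d, (∀ k, |z k| ≤ 4 * (R : ℤ)) → ∀ a, ‖div₂ M z a‖ ≤ M₁) →
    (∀ z : Site d, (∀ k, |z k| ≤ 4 * (R : ℤ)) → ∀ a b c, ‖d₂ M z a b c‖ ≤ M₂) →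
    ∀ j κ μ : Fin d, ‖M (e j) κ μ - M 0 κ μ‖ ≤ C * (1 + Real.log R) * ((d + 2) * (M₁ + M₂) + M₀ / R) ∧
      ‖M (-e j) κ μ - M 0 κ μ‖ ≤ C * (1 + Real.log R) * ((d + 2) * (M₁ + M₂) + M₀ / R) := by
  obtain ⟨C, hC, h⟩ := divForm_norm_sub_le (d := d) (E := E) hd
  refine ⟨C, hC, fun R hR M M₀ M₁ M₂ hM hdiv hd₂ j κ μ => ?_⟩
  -- the `d + 2` data terms
  set G : Fin d → Site d → E := fun a z => d₂ M z a κ μ with hG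
  set H : Fin 2 → Site d → E := ![fun z => div₂ M z μ, fun z => -div₂ M z κ] with hH
  set g : Fin (d + 2) → Site d → E := Fin.append G H with hg
  set vG : Fin d → Site d := fun a => -e a with hvG
  set vH : Fin 2 → Site d := ![e κ, e μ] with hvH
  set v : Fin (d + 2) → Site d := Fin.append vG vH with hv
  have hM1 : 0 ≤ M₁ := (norm_nonneg _).trans (hdiv 0 (fun k => by simp only [Pi.zero_apply, abs_zero]; positivity) κ)
  have hM2 : 0 ≤ M₂ := (norm_nonneg _).trans (hd₂ 0 (fun k => by simp only [Pi.zero_apply, abs_zero]; positivity) j κ μ)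
  have hres := h R hR (d + 2) (fun z => M z κ μ) g v M₀ (M₁ + M₂) (fun k => ?_) (fun z hz => hM z hz κ μ) (fun z hz k => ?_)
    (fun z hz => ?_) j
  · have e1 : ((d + 2 : ℕ) : ℝ) * (M₁ + M₂) = ((d : ℝ) + 2) * (M₁ + M₂) := by push_cast; ring
    rw [e1] at hres
    exact hres
  · -- unit steps
    refine Fin.addCases (fun a => ⟨a, Or.inr ?_⟩) (fun b => ?_) k
    · simp [hv, hvG]
    · fin_cases b
      · exact ⟨κ, Or.inl (by simp [hv, hvH])⟩
      · exact ⟨μ, Or.inl (by simp [hv, hvH])⟩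
  · -- data bounds
    refine Fin.addCases (fun a => ?_) (fun b => ?_) k
    · simp only [hg, Fin.append_left, hG]
      exact (hd₂ z hz a κ μ).trans (by linarith)
    · fin_cases b
      · simp only [hg, hH, Fin.append_right]
        exact (hdiv z hz μ).trans (by linarith)
      · simp only [hg, hH, Fin.append_right]
        simp only [Fin.mk_one, Matrix.cons_val_one, Matrix.cons_val_zero, norm_neg]
        exact (hdiv z hz κ).trans (by linarith)
  · -- the Hodge identity, component `(κ, μ)` at `z`
    have hHodge := congrFun (congrFun (congrFun (div₃_d₂_add_d₁_div₂ M) z) κ) μ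
    simp only [Pi.add_apply] at hHodge
    rw [show ∑ i, ((M z κ μ - M (z + e i) κ μ) + (M z κ μ - M (z - e i) κ μ)) = negLap₂ M z κ μ from rfl, ← hHodge]
    rw [hg, hv, Fin.sum_univ_add]
    simp only [Fin.append_left, Fin.append_right, hG, hH, hvG, hvH, Fin.sum_univ_two, Matrix.cons_val_zero, Matrix.cons_val_one]
    simp only [div₃, d₁, ← sub_eq_add_neg]
    abel

end Summit.QuantumFields.YangMills.Theorems.CurvGradFlat

end
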